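import Summits.BirchSwinnertonDyer.Rank1Residual.X11b.CertificateRecordsGeneric
import Summits.BirchSwinnertonDyer.Rank1Residual.X11b.MultiplicativeSurjectivity
import Summits.BirchSwinnertonDyer.BirchSwinnertonDyer.Theorems.Rank1ResidualIntModelSurjectivity
import HarnessLib

/-!
# BSD rank-≤1 residual cell, class X11b ∧ r = 1 ∧ p ≥ 5 WITHOUT a (ram) prime (`ρ̄_{E,p}` onto):
# certificate records checked by ONE Bool function — `fullCheckSurj`: the checks and their
# soundness (`Mult`, split type, `Irr`, `¬sst`, `Surj` from the record); the `BSD(E,p)` consumer is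
# `CertificateRecordsGenericSurj.lean` (Kato–Wuthrich divisibility instead of Skinner 2016 Thm. A)

HONEST FRAMING (cell `b2b-bsdres-*`, verbatim): prove what is provable now; shrink each hard class
to its core with data; no claim beyond stated classes; COMBINATION classes deleted from PUBLISHED
theorems only, CONSTRUCTION-shaped remainder typed; this is not "finishing BSD". Class X11b stays
CONSTRUCTION-SHAPED; everything here is PER PAIR; nothing is booked; no named fact. Unit
`b2b-bsdres-x11c` (gen 10). Companion of `CertificateRecordsGeneric.lean` (the (ram) route).

Of the 4 272 X11b ∧ r = 1 ∧ p ≥ 5 lane-residue pairs at `N < 5·10⁵`, 137 have NO (ram) prime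
(every multiplicative `ℓ ≠ p` has `p ∣ v_ℓ(Δ_min)`) but `ρ̄_{E,p}` onto; for them the divisibility is
Kato's (Wuthrich 2014 Thm. 3 / Cor. 19, SW 2013 Thm. 7.3; named fact
`kato_charIdeal_dvd_multiplicative_of_surjective`, A32) and the consumer of record is
`Typed.X11.bsdp_of_katoSurj_{split,nonsplit}_of_surjective_pow_of_certificate`, exactly as for the
11 (ram)-free in-window records (`Rank1ResidualX11RankOneCore`, `X11RankOneCertificates.Claim`).
This file gives the Bool checks and their SOUNDNESS, proved once:

* `multCheck` — `p` prime (trial division), `5 ≤ p`, `p ∤ shaAn`, `p ∣ Δ`, `p ∤ c₄`, a root / no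
  root of the node-tangent quadratic per the split bit (= `redCheck` without the (ram) witness)
  ⟹ `Mult` and the split type;
* `nsstCheck` — a listed bad prime `q` with `q ∣ Δ`, `q ∣ c₄` (additive) ⟹ `¬ Semistable`
  (`IntModel.not_semistable_of_intModel`), the `r = 1 ∧ ¬sst` clause of `ClassX11`;
* `surjCheck` — EITHER the integer test `pᵉ ‖ Δ_min`, `p ∤ e` (Serre 1972 §1.12 valuation half,
  kernel theorem `GaloisImage.surj_of_mult_of_irr_of_not_dvd`, x11c gen 8 / multr1-p2) OR Serre's
  three Frobenius witnesses (Prop. 19) in integer arithmetic on the recorded primes `r.serre`, with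
  `a_ℓ = ℓ + 1 − countPoints` (the schema's naive count = `#Ẽ(𝔽_ℓ)`, `natCard_point_eq_countPoints`)
  ⟹ `Surj` (`IntModel.hasSurjectiveModNGaloisRep_of_intModel_of_serreWitnesses`);
* `fullCheckSurj := checkSupport ∧ minCheck ∧ multCheck ∧ irrCheck ∧ nsstCheck ∧ surjCheck`;
  **`bsdp_of_fullCheckSurj`**: a record with `fullCheckSurj r = true`, the published facts A32 (Kato–
  Wuthrich), Stein–Wuthrich 2013 Thm. 6.1 split/non-split (A37), §4.2 height existence (A38),
  Wuthrich 2014 Prop. 21, GZK (A18), modularity (`L(E,s)` entire, a modular parametrisation) and the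
  three engine numbers (analytic rank `1`, `#Ш_an` as recorded, the two-engine certificate
  `CertSplit`/`CertNonsplit`) give Miller's `BSD(E,p)`; `bsdp_of_all_fullCheckSurj` is the batch form.

References: J.-P. Serre, Invent. Math. 15 (1972) §1.12, §2.8 Prop. 19 [Serre1972]; B. Mazur,
Invent. Math. 44 (1978) Prop. 6.3 (1) [Mazur1978]; C. Wuthrich, J. London Math. Soc. 90 (2014)
Thm. 3, Cor. 19, Prop. 21 [Wuthrich2014]; W. Stein and C. Wuthrich, Math. Comp. 82 (2013) Thm. 6.1,
Thm. 7.3, §4.2 [SteinWuthrich2013]; J. H. Silverman, *AEC* (2009) VII.5 Prop. 5.1 [SilvermanAEC2009].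
-/

set_option autoImplicit false

noncomputable section

open scoped Classical MatrixGroups ModularForm

open CongruenceSubgroup WeierstrassCurve Literature.NumberTheory.EllipticCurves
  Literature.NumberTheory.EllipticCurves.ModularForms
  Literature.NumberTheory.EllipticCurves.Rank1Residual
  Literature.NumberTheory.EllipticCurves.Rank1Residual.Typed
  Literature.NumberTheory.EllipticCurves.Skinner2016
  Literature.NumberTheory.EllipticCurves.Wuthrich2014
  Literature.NumberTheory.EllipticCurves.SteinWuthrich2013
  Literature.NumberTheory.EllipticCurves.Rank1Residual.X11RankOneCertificates
  Summit.BirchSwinnertonDyer.BirchSwinnertonDyer.Rank1Residual.IntModel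
  Summit.BirchSwinnertonDyer.BirchSwinnertonDyer.Rank1Residual.X11RankOne

namespace Summit.BirchSwinnertonDyer.Rank1Residual.X11b

/-! ### §1. The checks -/

section Defs

/-- Multiplicative-reduction check of a record (`redCheck` without the (ram) witness): `p` prime and
`≥ 5`, `p ∤ shaAn`, `p ∣ Δ`, `p ∤ c₄`, a root (split) / no root (non-split) `t < p` of `nodeQuad`.
[cite: SilvermanAEC2009, VII.5 Prop. 5.1] -/
def multCheck (r : Record) : Bool :=
  isPrimeBelow504100 r.p && decide (5 ≤ r.p) && decide (¬ r.p ∣ r.shaAn) &&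
  decide ((r.p : ℤ) ∣ discOf r.ainvs) && decide (¬ (r.p : ℤ) ∣ c4Of r.ainvs) &&
  (if r.split then (List.range r.p).any (fun t => decide ((r.p : ℤ) ∣ nodeQuad r.ainvs t))
    else (List.range r.p).all (fun t => decide (¬ (r.p : ℤ) ∣ nodeQuad r.ainvs t)))

/-- Non-semistability witness: a listed bad prime `q` with `q ∣ Δ` and `q ∣ c₄` (additive reduction of
the minimal model). [cite: SilvermanAEC2009, VII.5 Prop. 5.1(c)] -/
def nsstCheck (r : Record) : Bool :=
  r.bad.any (fun b => isPrimeBelow504100 b.1 &&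
    decide ((b.1 : ℤ) ∣ discOf r.ainvs) && decide ((b.1 : ℤ) ∣ c4Of r.ainvs))

/-- The integer surjectivity test at the multiplicative prime `p`: `pᵉ ‖ Δ` with `p ∤ e` for the listed
exponent `e = v_p(Δ)` (then `Mult ∧ Irr ⟹ Surj`, Serre 1972 §1.12). [cite: Serre1972, §1.12] -/
def valSurjCheck (r : Record) : Bool :=
  r.bad.any (fun b => decide (b.1 = r.p) && decide ((r.p : ℤ) ^ b.2.2 ∣ discOf r.ainvs) &&
    decide (¬ (r.p : ℤ) ^ (b.2.2 + 1) ∣ discOf r.ainvs) && decide (¬ r.p ∣ b.2.2))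

/-- Admissibility of a Serre witness prime: `3 ≤ ℓ` prime, `ℓ ≠ p`, `ℓ ∤ Δ` (good reduction). [folklore] -/
def serreAdm (r : Record) (ℓ : ℕ) : Bool :=
  decide (3 ≤ ℓ) && isPrimeBelow504100 ℓ && decide (ℓ ≠ r.p) && decide (¬ (ℓ : ℤ) ∣ discOf r.ainvs)

/-- Serre's criterion (Prop. 19) on the three recorded witness primes `(ℓᵢ, aᵢ)`, in integer
arithmetic, with `aᵢ` RECOMPUTED as `apNaive = ℓ + 1 − countPoints`: `s₁`: `a₁² − 4ℓ₁` a non-zero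
square mod `p` and `a₁ ≢ 0`; `s₂`: `a₂² − 4ℓ₂` a non-square mod `p` and `a₂ ≢ 0`; `s₃`: some
`u < p` with `a₃² ≡ uℓ₃`, `u ≢ 0, 1, 2, 4`, `u² − 3u + 1 ≢ 0`. [cite: Serre1972, §2.8 Prop. 19] -/
def serreCheckInt (r : Record) : Bool :=
  match r.serre with
  | [(l1, t1), (l2, t2), (l3, t3)] =>
    serreAdm r l1 && serreAdm r l2 && serreAdm r l3 &&
    (apNaive r.ainvs l1 == t1) && (apNaive r.ainvs l2 == t2) && (apNaive r.ainvs l3 == t3) &&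
    (List.range r.p).any (fun x => decide ((r.p : ℤ) ∣ (x : ℤ) ^ 2 - (t1 * t1 - 4 * l1))) &&
    decide (¬ (r.p : ℤ) ∣ t1 * t1 - 4 * l1) && decide (¬ (r.p : ℤ) ∣ t1) &&
    (List.range r.p).all (fun x => decide (¬ (r.p : ℤ) ∣ (x : ℤ) ^ 2 - (t2 * t2 - 4 * l2))) &&
    decide (¬ (r.p : ℤ) ∣ t2) &&
    (List.range r.p).any (fun u => decide ((r.p : ℤ) ∣ t3 * t3 - (u : ℤ) * l3) &&
      decide (¬ (r.p : ℤ) ∣ (u : ℤ)) && decide (¬ (r.p : ℤ) ∣ (u : ℤ) - 1) &&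
      decide (¬ (r.p : ℤ) ∣ (u : ℤ) - 2) && decide (¬ (r.p : ℤ) ∣ (u : ℤ) - 4) &&
      decide (¬ (r.p : ℤ) ∣ (u : ℤ) ^ 2 - 3 * u + 1))
  | _ => false

/-- Surjectivity check: the integer valuation test or Serre's three witnesses. [folklore] -/
def surjCheck (r : Record) : Bool := valSurjCheck r || serreCheckInt r

/-- The full check of a certificate record on the surjective-image (no (ram)) route. [folklore] -/
def fullCheckSurj (r : Record) : Bool :=
  r.checkSupport && minCheck r && multCheck r && irrCheck r && nsstCheck r && surjCheck r

end Defs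

/-! ### §2. Soundness of the checks -/

section Sound

variable (r : Record)

/-- A record passing `multCheck` has `p` prime, `5 ≤ p`, `p ∤ shaAn`. [folklore] -/
theorem prime_of_multCheck (h : multCheck r = true) : r.p.Prime ∧ 5 ≤ r.p ∧ ¬ r.p ∣ r.shaAn := by
  unfold multCheck at h
  simp only [Bool.and_eq_true, decide_eq_true_eq] at h
  exact ⟨prime_of_isPrimeBelow504100 h.1.1.1.1.1, h.1.1.1.1.2, h.1.1.1.2⟩

/-- `ord_p (shaAn : ℚ) = 0` for a record passing `multCheck`. [folklore] -/
theorem padicValRat_shaAn_eq_zero_of_multCheck (h : multCheck r = true) :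
    padicValRat r.p (r.shaAn : ℚ) = 0 := by
  rw [padicValRat.of_nat]
  exact_mod_cast padicValNat.eq_zero_of_not_dvd (prime_of_multCheck r h).2.2

/-- **`Mult` and the split type from `checkSupport ∧ multCheck`** (any instances).
[cite: SilvermanAEC2009, VII.5 Prop. 5.1] -/
theorem mult_of_multCheck [Fact r.p.Prime] [r.curve.IsElliptic] [r.curve.IsGloballyMinimal]
    (hs : r.checkSupport = true) (hm : multCheck r = true) :
    Mult r.curve r.p ∧ (r.split = true → r.curve.HasSplitMultiplicativeReductionAtPrime r.p) ∧
    (r.split = false → ¬ r.curve.HasSplitMultiplicativeReductionAtPrime r.p) := by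
  haveI : NeZero r.p := ⟨(Fact.out : r.p.Prime).ne_zero⟩
  obtain ⟨a1, a2, a3, a4, a6, hA⟩ := exists_ainvs_of_checkSupport r hs
  have hm' := hm
  unfold multCheck at hm'
  simp only [Bool.and_eq_true, decide_eq_true_eq] at hm'
  obtain ⟨⟨⟨-, hpΔ⟩, hpc4⟩, hsplit⟩ := hm'
  rw [hA] at hpΔ hpc4 hsplit
  set E₀ : WeierstrassCurve ℤ := ⟨a1, a2, a3, a4, a6⟩ with hE₀
  have hI : integralModelInt r.curve = E₀ := integralModelInt_curve r hA
  have hΔ : E₀.Δ = discOf [a1, a2, a3, a4, a6] := intCurve_Δ a1 a2 a3 a4 a6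
  have hc4 : E₀.c₄ = c4Of [a1, a2, a3, a4, a6] := intCurve_c₄ a1 a2 a3 a4 a6
  have hb2 := intCurve_b₂ a1 a2 a3 a4 a6
  have hb4 := intCurve_b₄ a1 a2 a3 a4 a6
  have hb6 := intCurve_b₆ a1 a2 a3 a4 a6
  have hpΔ' : (r.p : ℤ) ∣ E₀.Δ := by rw [hΔ]; exact hpΔ
  have hpc4' : ¬ (r.p : ℤ) ∣ E₀.c₄ := by rw [hc4]; exact hpc4
  have hnode : ∀ t : ℕ,
      ((E₀.c₄ : ZMod r.p) * (t : ZMod r.p) ^ 2 + (E₀.a₁ * E₀.c₄ : ZMod r.p) * (t : ZMod r.p)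
        - (54 * E₀.b₆ - 3 * E₀.b₂ * E₀.b₄ + E₀.a₂ * E₀.c₄ : ZMod r.p)) =
      ((nodeQuad [a1, a2, a3, a4, a6] t : ℤ) : ZMod r.p) := by
    intro t
    rw [hc4, hb2, hb4, hb6]
    simp only [hE₀, nodeQuad, List.getD_cons_zero, List.getD_cons_succ]
    push_cast
    ring
  refine ⟨hasMultiplicativeReductionAtPrime_of_intModel hI r.p hpΔ' hpc4', ?_, ?_⟩
  · intro hsp
    rw [hsp] at hsplit
    simp only [if_true, List.any_eq_true, List.mem_range, decide_eq_true_eq] at hsplit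
    obtain ⟨t, -, ht⟩ := hsplit
    refine hasSplitMultiplicativeReductionAtPrime_of_intModel_of_root hI r.p hpΔ' hpc4' ⟨(t : ZMod r.p), ?_⟩
    rw [hnode, ZMod.intCast_zmod_eq_zero_iff_dvd]
    exact ht
  · intro hsp
    rw [hsp] at hsplit
    simp only [Bool.false_eq_true, if_false, List.all_eq_true, List.mem_range, decide_eq_true_eq] at hsplit
    refine not_hasSplitMultiplicativeReductionAtPrime_of_intModel_of_noroot hI r.p hpΔ' hpc4'
      (forall_zmod_of_forall_lt fun t ht ↦ ?_)
    rw [hnode, Ne, ZMod.intCast_zmod_eq_zero_iff_dvd]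
    exact hsplit t ht

/-- **`E[p]` irreducible from `checkSupport ∧ irrCheck`** (Frobenius witness, Mazur 1978 Prop. 6.3 (1)).
[cite: Mazur1978, §6 Prop. 6.3 (1) (p. 153)] -/
theorem irr_of_irrCheck [Fact r.p.Prime] [r.curve.IsElliptic] [r.curve.IsGloballyMinimal]
    (hs : r.checkSupport = true) (hirr : irrCheck r = true) : Irr r.curve r.p := by
  haveI : NeZero r.p := ⟨(Fact.out : r.p.Prime).ne_zero⟩
  obtain ⟨a1, a2, a3, a4, a6, hA⟩ := exists_ainvs_of_checkSupport r hs
  have hirr' := hirr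
  unfold irrCheck at hirr'
  obtain ⟨ℓ, -, hℓ⟩ := List.any_eq_true.mp hirr'
  unfold irrCheckAt at hℓ
  simp only [Bool.and_eq_true, decide_eq_true_eq, List.all_eq_true, List.mem_range] at hℓ
  obtain ⟨⟨⟨⟨hℓ3, hℓprime⟩, hℓp⟩, hℓΔ⟩, hnoroot⟩ := hℓ
  rw [hA] at hℓΔ hnoroot
  set E₀ : WeierstrassCurve ℤ := ⟨a1, a2, a3, a4, a6⟩ with hE₀
  have hI : integralModelInt r.curve = E₀ := integralModelInt_curve r hA
  have hΔ : E₀.Δ = discOf [a1, a2, a3, a4, a6] := intCurve_Δ a1 a2 a3 a4 a6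
  haveI hℓP : Fact ℓ.Prime := ⟨prime_of_isPrimeBelow504100 hℓprime⟩
  have hℓ2 : ℓ ≠ 2 := by omega
  have hℓΔ' : ¬ (ℓ : ℤ) ∣ E₀.Δ := by rw [hΔ]; exact hℓΔ
  have hcardZ := natCard_point_eq_countPoints a1 a2 a3 a4 a6 ℓ hℓ2 hℓΔ'
  set n : ℕ := Nat.card ((E₀.map (Int.castRingHom (ZMod ℓ))).toAffine.Point) with hn
  have hcp : countPoints [a1, a2, a3, a4, a6] ℓ = (n : ℤ) := hcardZ.symm
  refine hasIrreducibleModPGaloisRep_of_intModel_of_noroot hI r.p ℓ hℓp hℓΔ' (n := n) rfl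
    (forall_zmod_of_forall_lt fun t ht h0 ↦ hnoroot t ht ?_)
  rw [← ZMod.intCast_zmod_eq_zero_iff_dvd, hcp]
  push_cast at h0 ⊢
  linear_combination h0

/-- **`E` is not semistable from `checkSupport ∧ nsstCheck`** (an additive bad prime).
[cite: SilvermanAEC2009, VII.5 Prop. 5.1(c)] -/
theorem not_semistable_of_nsstCheck [r.curve.IsElliptic] [r.curve.IsGloballyMinimal]
    (hs : r.checkSupport = true) (hn : nsstCheck r = true) : ¬ Semistable r.curve := by
  obtain ⟨a1, a2, a3, a4, a6, hA⟩ := exists_ainvs_of_checkSupport r hs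
  unfold nsstCheck at hn
  obtain ⟨b, -, hb⟩ := List.any_eq_true.mp hn
  simp only [Bool.and_eq_true, decide_eq_true_eq] at hb
  obtain ⟨⟨hprime, hΔb⟩, hc4b⟩ := hb
  rw [hA] at hΔb hc4b
  set E₀ : WeierstrassCurve ℤ := ⟨a1, a2, a3, a4, a6⟩ with hE₀
  have hI : integralModelInt r.curve = E₀ := integralModelInt_curve r hA
  have hΔ : E₀.Δ = discOf [a1, a2, a3, a4, a6] := intCurve_Δ a1 a2 a3 a4 a6
  have hc4 : E₀.c₄ = c4Of [a1, a2, a3, a4, a6] := intCurve_c₄ a1 a2 a3 a4 a6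
  exact not_semistable_of_intModel hI b.1 (prime_of_isPrimeBelow504100 hprime)
    (by rw [hΔ]; exact hΔb) (by rw [hc4]; exact hc4b)

/-- **`ρ̄_{E,p}` onto from `checkSupport ∧ valSurjCheck` given `Mult` and `Irr`** (`p ∤ ord_p Δ_min`;
Serre 1972 §1.12 valuation half, kernel theorem `GaloisImage.surj_of_mult_of_irr_of_not_dvd`).
[cite: Serre1972, §1.12] -/
theorem surj_of_valSurjCheck [Fact r.p.Prime] [r.curve.IsElliptic] [r.curve.IsGloballyMinimal]
    (hs : r.checkSupport = true) (hp2 : r.p ≠ 2) (hmult : Mult r.curve r.p) (hirr : Irr r.curve r.p)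
    (hv : valSurjCheck r = true) : Surj r.curve r.p := by
  obtain ⟨a1, a2, a3, a4, a6, hA⟩ := exists_ainvs_of_checkSupport r hs
  unfold valSurjCheck at hv
  obtain ⟨b, -, hb⟩ := List.any_eq_true.mp hv
  simp only [Bool.and_eq_true, decide_eq_true_eq] at hb
  obtain ⟨⟨⟨-, he⟩, he'⟩, hpe⟩ := hb
  rw [hA] at he he'
  set E₀ : WeierstrassCurve ℤ := ⟨a1, a2, a3, a4, a6⟩ with hE₀
  have hI : integralModelInt r.curve = E₀ := integralModelInt_curve r hA
  have hΔ : E₀.Δ = discOf [a1, a2, a3, a4, a6] := intCurve_Δ a1 a2 a3 a4 a6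
  exact GaloisImage.surj_of_mult_of_irr_of_not_dvd r.curve r.p hp2 hmult hirr (by
    rw [minimalDiscriminantInt_eq hI, padicValInt_eq_of_dvd_of_not_dvd r.p (by rw [hΔ]; exact he)
      (by rw [hΔ]; exact he')]
    exact hpe)

/-- Casting helper: `(p : ℤ) ∣ a - b` iff `a = b` in `ZMod p`. [folklore] -/
theorem intCast_eq_intCast_iff_dvd_sub (p : ℕ) (a b : ℤ) :
    ((a : ZMod p) = (b : ZMod p)) ↔ (p : ℤ) ∣ a - b := by
  rw [← sub_eq_zero, ← Int.cast_sub, ZMod.intCast_zmod_eq_zero_iff_dvd]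

/-- **`ρ̄_{E,p}` onto from `checkSupport ∧ serreCheckInt`, `5 ≤ p`** (Serre's three Frobenius
witnesses, Prop. 19; `a_ℓ` recomputed by point counting, `natCard_point_eq_countPoints`).
[cite: Serre1972, §2.8 Prop. 19] -/
theorem surj_of_serreCheckInt [Fact r.p.Prime] [r.curve.IsElliptic] [r.curve.IsGloballyMinimal]
    (hs : r.checkSupport = true) (h5 : 5 ≤ r.p) (hv : serreCheckInt r = true) : Surj r.curve r.p := by
  haveI : NeZero r.p := ⟨(Fact.out : r.p.Prime).ne_zero⟩
  obtain ⟨a1, a2, a3, a4, a6, hA⟩ := exists_ainvs_of_checkSupport r hs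
  unfold serreCheckInt at hv
  rcases hS : r.serre with _ | ⟨⟨l1, t1⟩, _ | ⟨⟨l2, t2⟩, _ | ⟨⟨l3, t3⟩, _ | ⟨x4, rest⟩⟩⟩⟩ <;>
    simp only [hS, Bool.false_eq_true] at hv
  simp only [serreAdm, Bool.and_eq_true, decide_eq_true_eq, beq_iff_eq, List.any_eq_true,
    List.all_eq_true, List.mem_range] at hv
  obtain ⟨⟨⟨⟨⟨⟨⟨⟨⟨⟨⟨hadm1, hadm2⟩, hadm3⟩, ht1⟩, ht2⟩, ht3⟩, hsq1⟩, hd1⟩, ht1nz⟩, hnsq2⟩, ht2nz⟩, hu⟩ := hv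
  obtain ⟨⟨⟨h31, hpr1⟩, hne1⟩, hΔ1⟩ := hadm1
  obtain ⟨⟨⟨h32, hpr2⟩, hne2⟩, hΔ2⟩ := hadm2
  obtain ⟨⟨⟨h33, hpr3⟩, hne3⟩, hΔ3⟩ := hadm3
  rw [hA] at ht1 ht2 ht3 hΔ1 hΔ2 hΔ3
  set E₀ : WeierstrassCurve ℤ := ⟨a1, a2, a3, a4, a6⟩ with hE₀
  have hI : integralModelInt r.curve = E₀ := integralModelInt_curve r hA
  have hΔ : E₀.Δ = discOf [a1, a2, a3, a4, a6] := intCurve_Δ a1 a2 a3 a4 a6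
  haveI hP1 : Fact l1.Prime := ⟨prime_of_isPrimeBelow504100 hpr1⟩
  haveI hP2 : Fact l2.Prime := ⟨prime_of_isPrimeBelow504100 hpr2⟩
  haveI hP3 : Fact l3.Prime := ⟨prime_of_isPrimeBelow504100 hpr3⟩
  have hΔ1' : ¬ (l1 : ℤ) ∣ E₀.Δ := by rw [hΔ]; exact hΔ1
  have hΔ2' : ¬ (l2 : ℤ) ∣ E₀.Δ := by rw [hΔ]; exact hΔ2
  have hΔ3' : ¬ (l3 : ℤ) ∣ E₀.Δ := by rw [hΔ]; exact hΔ3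
  have hc1 := natCard_point_eq_countPoints a1 a2 a3 a4 a6 l1 (by omega) hΔ1'
  have hc2 := natCard_point_eq_countPoints a1 a2 a3 a4 a6 l2 (by omega) hΔ2'
  have hc3 := natCard_point_eq_countPoints a1 a2 a3 a4 a6 l3 (by omega) hΔ3'
  set n1 : ℕ := Nat.card ((E₀.map (Int.castRingHom (ZMod l1))).toAffine.Point) with hn1
  set n2 : ℕ := Nat.card ((E₀.map (Int.castRingHom (ZMod l2))).toAffine.Point) with hn2
  set n3 : ℕ := Nat.card ((E₀.map (Int.castRingHom (ZMod l3))).toAffine.Point) with hn3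
  -- the recorded traces are the Frobenius traces
  have hk1 : ((l1 : ℤ) + 1 - n1 : ℤ) = t1 := by simp only [apNaive] at ht1; rw [hc1]; exact ht1
  have hk2 : ((l2 : ℤ) + 1 - n2 : ℤ) = t2 := by simp only [apNaive] at ht2; rw [hc2]; exact ht2
  have hk3 : ((l3 : ℤ) + 1 - n3 : ℤ) = t3 := by simp only [apNaive] at ht3; rw [hc3]; exact ht3
  set P : ℕ := r.p with hPdef
  have castD : ∀ (t : ℤ) (l : ℕ), (((t * t - 4 * l : ℤ) : ℤ) : ZMod P) = (t : ZMod P) ^ 2 - 4 * (l : ZMod P) := by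
    intro t l; push_cast; ring
  refine hasSurjectiveModNGaloisRep_of_intModel_of_serreWitnesses hI P h5 l1 l2 l3 hne1 hne2 hne3
    hΔ1' hΔ2' hΔ3' hn1.symm hn2.symm hn3.symm ?_ ?_ ?_
  · rw [hk1]
    obtain ⟨x, -, hx⟩ := hsq1
    refine ⟨⟨(x : ZMod P), ?_⟩, ?_, ?_⟩
    · have hx' : (((x : ℤ) ^ 2 : ℤ) : ZMod P) = (((t1 * t1 - 4 * l1 : ℤ)) : ZMod P) :=
        (intCast_eq_intCast_iff_dvd_sub P _ _).mpr hx
      rw [← castD, ← hx']; push_cast; ring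
    · intro h0
      apply hd1
      rw [← ZMod.intCast_zmod_eq_zero_iff_dvd, castD]; exact h0
    · intro h0
      exact ht1nz ((ZMod.intCast_zmod_eq_zero_iff_dvd t1 P).mp h0)
  · rw [hk2]
    refine ⟨?_, fun h0 ↦ ht2nz ((ZMod.intCast_zmod_eq_zero_iff_dvd t2 P).mp h0)⟩
    rintro ⟨y, hy⟩
    apply hnsq2 y.val (ZMod.val_lt y)
    rw [← intCast_eq_intCast_iff_dvd_sub, castD, hy]
    push_cast
    rw [ZMod.natCast_zmod_val]
    ring
  · rw [hk3]
    obtain ⟨u, -, ⟨⟨⟨⟨⟨hu3, hu0⟩, hu1⟩, hu2⟩, hu4⟩, huq⟩⟩ := hu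
    have hU : ((u : ℤ) : ZMod P) = (u : ZMod P) := by push_cast; rfl
    refine ⟨(u : ZMod P), ?_, ?_, ?_, ?_, ?_, ?_⟩
    · have := (intCast_eq_intCast_iff_dvd_sub P (t3 * t3) ((u : ℤ) * l3)).mpr hu3
      have h' : ((t3 : ℤ) : ZMod P) ^ 2 = (((t3 * t3 : ℤ)) : ZMod P) := by push_cast; ring
      rw [h', this]; push_cast; ring
    · intro h0; apply hu0; rw [← ZMod.intCast_zmod_eq_zero_iff_dvd, hU]; exact h0
    · intro h0; apply hu1
      rw [← ZMod.intCast_zmod_eq_zero_iff_dvd]; push_cast; rw [h0]; ring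
    · intro h0; apply hu2
      rw [← ZMod.intCast_zmod_eq_zero_iff_dvd]; push_cast; rw [h0]; ring
    · intro h0; apply hu4
      rw [← ZMod.intCast_zmod_eq_zero_iff_dvd]; push_cast; rw [h0]; ring
    · intro h0; apply huq
      rw [← ZMod.intCast_zmod_eq_zero_iff_dvd]; push_cast; exact h0

/-- **`ρ̄_{E,p}` onto from `checkSupport ∧ surjCheck`, given `5 ≤ p`, `Mult`, `Irr`.**
[cite: Serre1972, §1.12 and §2.8 Prop. 19] -/
theorem surj_of_surjCheck [Fact r.p.Prime] [r.curve.IsElliptic] [r.curve.IsGloballyMinimal]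
    (hs : r.checkSupport = true) (h5 : 5 ≤ r.p) (hmult : Mult r.curve r.p) (hirr : Irr r.curve r.p)
    (hv : surjCheck r = true) : Surj r.curve r.p := by
  unfold surjCheck at hv
  rcases Bool.or_eq_true _ _ |>.mp hv with h | h
  · exact surj_of_valSurjCheck r hs (by omega) hmult hirr h
  · exact surj_of_serreCheckInt r hs h5 h

end Sound

end Summit.BirchSwinnertonDyer.Rank1Residual.X11b

end
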